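import Mathlib
import HarnessLib

/-!
# QUANT lane R8, T-DEC, leg (III), blob case — `LawDec.GatedSliceMixLaw'`, Q-alone side: the SCALAR INEQUALITIES of the twin-open cell of class `mm`
# (surplus inequalities I2 in the open-heavy and closed forms, the resulting offer inequalities, and `u·z ≤ D` from the mean identity)

builds on p205010 (kernel theorem, internal audit signed; external expert review pending)

Support file (`--supports stmt-CriticalPhenomena-4575`), QUANT lane seat prim-quant-arm-1 (gen 41), rung R8 of
`run/shared/lean/prim/quant/LADDER.md`.  Pure real-arithmetic lemmas (theorems only, standard axioms, no sorries), consumed by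
`…QuantGatedSliceMixLawQTwinOpen` (`mixLawQ_decAtT_twinOpen`).  Notation: `W = t − 2k₁`; `A, B, C, D` the masses of `Q` at `k₁, k₁+a, K = k₂, K+a`;
`t·z = −(t−k₁)A − (t−P)B − (t−K)C + (G−t)D` the mean identity; `capP·W = B(a−W)`, `capK·W = C(K+k₁−t)` the saturated capacities of the heavy twin / top.
Memo `run/shared/lean/prim/quant/prim-quant-arm-1-g41/Q-ALONE-G41.md` §4.  RATE class log\* / honest sentence unchanged.

[this work].  Nothing here is cited as a published result.  The gluing rows served [cite: KozmaNitzan2024, Conjecture 3 (p. 15)].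
-/

namespace Summit.CriticalPhenomena.PercolationContinuityZ3.Theorems

namespace Quant

namespace LawDec

/-! ### Scalar lemmas (small contexts) -/

/-- `u·z ≤ D` from the mean identity when every sub-target term is nonnegative. [this work] -/
theorem twinOpen_alpha (t y k₁ k₂ a A B C D z : ℝ) (hy0 : 0 < y) (ht0 : 0 < t)
    (htz : t * z = -((t - k₁) * A) - (t - (k₁ + a)) * B - (t - k₂) * C + (k₂ + a - t) * D)
    (hyG : y * (k₂ + a) ≤ t) (hA : 0 ≤ (t - k₁) * A) (hB : 0 ≤ (t - (k₁ + a)) * B) (hC : 0 ≤ (t - k₂) * C) (hD0 : 0 ≤ D) :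
    y * z ≤ (1 - y) * D := by
  have h1 : t * (y * z) ≤ t * ((1 - y) * D) := by
    have e : t * (y * z) = y * (t * z) := by ring
    rw [e, htz]
    nlinarith [mul_le_mul_of_nonneg_right hyG hD0]
  exact le_of_mul_le_mul_left h1 ht0


/-- I2, top open and heavy: `(1−λ)(W − 2ag) ≤ λ(1−g)(2K − t)`. [this work] -/
theorem twinOpen_I2_open (z g S t lam k₁ K a : ℝ) (hz0 : 0 ≤ z) (hz1 : z < 1) (hg0 : 0 < g) (hg1 : g ≤ 1) (hlam0 : 0 ≤ lam) (hlam1 : lam ≤ 1)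
    (hk₁ : 1 ≤ k₁) (ha : 1 ≤ a) (hmean : (1 - z) * (k₁ + (K - k₁) * lam) = S) (ht : t = S + a * g * (1 - z))
    (hWa : t - 2 * k₁ < a) (hKmid : t ≤ 2 * K) (hkK : k₁ < K) :
    (1 - lam) * ((t - 2 * k₁) - 2 * a * g) ≤ lam * (1 - g) * (2 * K - t) := by
  by_cases hW : t - 2 * k₁ ≤ 2 * a * g
  · have h1 : (1 - lam) * ((t - 2 * k₁) - 2 * a * g) ≤ 0 := mul_nonpos_of_nonneg_of_nonpos (by linarith) (by linarith)
    have h2 : 0 ≤ lam * (1 - g) * (2 * K - t) := mul_nonneg (mul_nonneg hlam0 (by linarith)) (by linarith)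
    linarith
  · have hW' : 2 * a * g < t - 2 * k₁ := not_le.1 hW
    have h1z : 0 < 1 - z := by linarith
    -- λ(K − k₁)(1−z) = S − (1−z)k₁ ≥ (1−z)(S − k₁)
    have e : lam * (2 * K - t) = 2 * (S / (1 - z) - k₁) + 2 * lam * k₁ - lam * t := by
      have : lam * (K - k₁) = S / (1 - z) - k₁ := by
        field_simp
        linarith [hmean]
      linarith [this]
    have hT : S ≤ S / (1 - z) := by
      rw [le_div_iff₀ h1z]
      have hS0 : 0 ≤ S := by rw [← hmean]; exact mul_nonneg h1z.le (by nlinarith)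
      nlinarith
    -- RHS − LHS ≥ ag(1−λ) + (1−g)(t − 2ag(1−z)) ≥ 0
    have hS : S = t - a * g * (1 - z) := by linarith
    have key : lam * (1 - g) * (2 * K - t) - (1 - lam) * ((t - 2 * k₁) - 2 * a * g)
        ≥ a * g * (1 - lam) + (1 - g) * (t - 2 * a * g * (1 - z)) := by
      rw [mul_assoc lam (1 - g), mul_comm (1 - g), ← mul_assoc, e]
      nlinarith [mul_le_mul_of_nonneg_left hT (by linarith : (0:ℝ) ≤ 1 - g),
        mul_le_mul_of_nonneg_left hWa.le (mul_nonneg hg0.le (by linarith : (0:ℝ) ≤ 1 - lam)),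
        mul_nonneg (by linarith : (0:ℝ) ≤ 1 - g) (by linarith : (0:ℝ) ≤ 1 - lam)]
    have hpos : 0 ≤ a * g * (1 - lam) + (1 - g) * (t - 2 * a * g * (1 - z)) := by
      have : 0 ≤ t - 2 * a * g * (1 - z) := by nlinarith
      have h1 : 0 ≤ a * g * (1 - lam) := mul_nonneg (mul_nonneg (by linarith) hg0.le) (by linarith)
      have h2 : 0 ≤ (1 - g) * (t - 2 * a * g * (1 - z)) := mul_nonneg (by linarith) this
      linarith
    linarith

/-- I2, top closed: `(1−λ)(W − 2ag) ≤ λ(1−g)W`. [this work] -/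
theorem twinOpen_I2_closed (z g S t lam k₁ K a : ℝ) (hz0 : 0 ≤ z) (hz1 : z < 1) (hg0 : 0 < g) (hg1 : g ≤ 1) (hlam0 : 0 ≤ lam) (hlam1 : lam ≤ 1)
    (hk₁ : 1 ≤ k₁) (ha : 1 ≤ a) (hmean : (1 - z) * (k₁ + (K - k₁) * lam) = S) (ht : t = S + a * g * (1 - z))
    (hWa : t - 2 * k₁ < a) (hKc : k₁ + K ≤ t) (hkK : k₁ < K) :
    (1 - lam) * ((t - 2 * k₁) - 2 * a * g) ≤ lam * (1 - g) * (t - 2 * k₁) := by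
  by_cases hW : t - 2 * k₁ ≤ 2 * a * g
  · have h1 : (1 - lam) * ((t - 2 * k₁) - 2 * a * g) ≤ 0 := mul_nonpos_of_nonneg_of_nonpos (by linarith) (by linarith)
    have h2 : 0 ≤ lam * (1 - g) * (t - 2 * k₁) := mul_nonneg (mul_nonneg hlam0 (by linarith)) (by linarith)
    linarith
  · have hW' : 2 * a * g < t - 2 * k₁ := not_le.1 hW
    have h1z : 0 < 1 - z := by linarith
    set W := t - 2 * k₁ with hWdef
    have hW0 : 0 < W := by nlinarith
    -- (1−λ)W ≤ ag(1−z) − k₁ : from λ(K−k₁) = S/(1−z) − k₁ ≥ S − k₁ and K − k₁ ≤ W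
    have hmu : (1 - lam) * W ≤ a * g * (1 - z) - k₁ := by
      have e1 : (1 - z) * ((K - k₁) * lam) = S - (1 - z) * k₁ := by linarith [hmean]
      have h2 : (1 - z) * ((K - k₁) * lam) ≤ (1 - z) * (W * lam) :=
        mul_le_mul_of_nonneg_left (mul_le_mul_of_nonneg_right (by linarith) hlam0) h1z.le
      have hS0 : 0 ≤ S := by rw [← hmean]; exact mul_nonneg h1z.le (by nlinarith)
      -- (1−z) W λ ≥ S − (1−z)k₁ ≥ (1−z)(S − k₁)
      have h3 : (1 - z) * (S - k₁) ≤ (1 - z) * (W * lam) := by nlinarith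
      have h4 : S - k₁ ≤ W * lam := le_of_mul_le_mul_left h3 h1z
      have hS : S = t - a * g * (1 - z) := by linarith
      nlinarith
    have hg12 : g < 1 / 2 := by nlinarith
    -- quadratic: with V = W − 2ag ≥ 0, μ = 1 − λ: μ(W − 2ag) ≤ (1−μ)(1−g)W  ⟸  μ W ≤ ag − k₁ ≤ ag
    -- (1−g)W² − ag((2−g)W − 2ag) = a²g²(2−2g) + agV(2−3g) + (1−g)V² ≥ 0
    have hmu' : (1 - lam) * W ≤ a * g := by nlinarith [mul_nonneg (mul_nonneg (by linarith : (0:ℝ) ≤ a) hg0.le) hz0]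
    have hV : 0 ≤ W - 2 * a * g := by linarith
    -- target ⟺ (1−λ)[(2−g)W − 2ag] ≤ (1−g)W ; multiply by W>0 and use (1−λ)W ≤ ag
    have key : (1 - lam) * ((2 - g) * W - 2 * a * g) * W ≤ (1 - g) * W * W := by
      have hpos : 0 ≤ (2 - g) * W - 2 * a * g := by nlinarith
      calc (1 - lam) * ((2 - g) * W - 2 * a * g) * W = ((1 - lam) * W) * ((2 - g) * W - 2 * a * g) := by ring
        _ ≤ (a * g) * ((2 - g) * W - 2 * a * g) := mul_le_mul_of_nonneg_right hmu' hpos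
        _ ≤ (1 - g) * W * W := by
            nlinarith [mul_nonneg hV (by linarith : (0:ℝ) ≤ 2 - 3 * g), mul_nonneg (mul_nonneg (by linarith : (0:ℝ) ≤ a) hg0.le) hV,
              sq_nonneg (W - 2 * a * g), mul_nonneg (mul_nonneg (by linarith : (0:ℝ) ≤ a) hg0.le) (mul_nonneg (by linarith : (0:ℝ) ≤ a) hg0.le)]
    have key' : ((1 - lam) * ((2 - g) * W - 2 * a * g)) * W ≤ ((1 - g) * W) * W := by linarith [key]
    have := le_of_mul_le_mul_right key' hW0
    nlinarith [this]

/-- piece 3, top open heavy, twin and top saturated: the offer inequality from I2. [this work] -/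
theorem twinOpen_beta_open (t y k₁ K a A B C D z capP capK W : ℝ) (hy0 : 0 < y) (ht0 : 0 < t) (hk₁0 : 0 ≤ k₁) (hW : W = t - 2 * k₁) (hW0 : 0 < W)
    (htz : t * z = -((t - k₁) * A) - (t - (k₁ + a)) * B - (t - K) * C + (K + a - t) * D)
    (hyG : y * (K + a) ≤ t) (hD0 : 0 ≤ D)
    (hcapP : capP * W = B * (a - W)) (hcapK : capK * W = C * (K + k₁ - t))
    (hI2 : A * W ≤ B * (2 * (k₁ + a) - t) + C * (2 * K - t)) :
    y * (z + (A - capP - capK)) ≤ (1 - y) * D := by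
  have e1 : t * (z + (A - capP - capK)) * W
      = (k₁ * A + (K + a - t) * D) * W - k₁ * B * (2 * (k₁ + a) - t) - k₁ * C * (2 * K - t) := by
    rw [hW] at hcapP hcapK ⊢
    linear_combination (t - 2 * k₁) * htz - t * hcapP - t * hcapK
  have hGD : (K + a - t) * D * y ≤ (t - t * y) * D := by nlinarith [mul_le_mul_of_nonneg_right hyG hD0]
  have hk : k₁ * (A * W - B * (2 * (k₁ + a) - t) - C * (2 * K - t)) ≤ 0 := mul_nonpos_of_nonneg_of_nonpos hk₁0 (by linarith)
  have h2 : y * (t * (z + (A - capP - capK)) * W) ≤ (t - t * y) * D * W := by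
    rw [e1]
    nlinarith [mul_le_mul_of_nonneg_right hGD hW0.le, mul_le_mul_of_nonneg_right (mul_le_mul_of_nonneg_left hk hy0.le) hW0.le]
  have h3 : (t * W) * (y * (z + (A - capP - capK))) ≤ (t * W) * ((1 - y) * D) := by
    have e2 : (t * W) * (y * (z + (A - capP - capK))) = y * (t * (z + (A - capP - capK)) * W) := by ring
    have e3 : (t * W) * ((1 - y) * D) = (t - t * y) * D * W := by ring
    rw [e2, e3]; exact h2
  exact le_of_mul_le_mul_left h3 (mul_pos ht0 hW0)

/-- piece 3, top closed, twin saturated: the offer inequality from I2. [this work] -/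
theorem twinOpen_beta_closed (t y k₁ K a A B C D z capP W : ℝ) (hy0 : 0 < y) (ht0 : 0 < t) (hk₁0 : 0 ≤ k₁) (hW : W = t - 2 * k₁) (hW0 : 0 < W)
    (htz : t * z = -((t - k₁) * A) - (t - (k₁ + a)) * B - (t - K) * C + (K + a - t) * D)
    (hyG : y * (K + a) ≤ t) (hC0 : 0 ≤ C) (hD0 : 0 ≤ D) (hKc : k₁ + K ≤ t)
    (hcapP : capP * W = B * (a - W))
    (hI2 : A * W ≤ B * (2 * (k₁ + a) - t) + C * W) :
    y * (z + (A - capP)) ≤ (1 - y) * D := by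
  have e1 : t * (z + (A - capP)) * W
      = (k₁ * A - (t - K) * C + (K + a - t) * D) * W - k₁ * B * (2 * (k₁ + a) - t) := by
    rw [hW] at hcapP ⊢
    linear_combination (t - 2 * k₁) * htz - t * hcapP
  have hGD : (K + a - t) * D * y ≤ (t - t * y) * D := by nlinarith [mul_le_mul_of_nonneg_right hyG hD0]
  have hc : k₁ * C ≤ (t - K) * C := mul_le_mul_of_nonneg_right (by linarith) hC0
  have hk : k₁ * (A * W - B * (2 * (k₁ + a) - t) - C * W) ≤ 0 := mul_nonpos_of_nonneg_of_nonpos hk₁0 (by linarith)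
  have h2 : y * (t * (z + (A - capP)) * W) ≤ (t - t * y) * D * W := by
    rw [e1]
    nlinarith [mul_le_mul_of_nonneg_right hGD hW0.le, mul_le_mul_of_nonneg_right (mul_le_mul_of_nonneg_left hk hy0.le) hW0.le,
      mul_le_mul_of_nonneg_right (mul_le_mul_of_nonneg_left hc hy0.le) hW0.le]
  have h3 : (t * W) * (y * (z + (A - capP))) ≤ (t * W) * ((1 - y) * D) := by
    have e2 : (t * W) * (y * (z + (A - capP))) = y * (t * (z + (A - capP)) * W) := by ring
    have e3 : (t * W) * ((1 - y) * D) = (t - t * y) * D * W := by ring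
    rw [e2, e3]; exact h2
  exact le_of_mul_le_mul_left h3 (mul_pos ht0 hW0)


end LawDec

end Quant

end Summit.CriticalPhenomena.PercolationContinuityZ3.Theorems
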